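import Summits.CriticalPhenomena.CardyFormulaZ2.Theses.CardyMonotoneApproach
import Literature.Probability.Percolation.RSWProofs
import HarnessLib

/-!
# Birth skeleton `Lines/birth.lean` for the crux `CardyMonotoneApproach.MonotoneApproach`
(item `stmt-CriticalPhenomena-5844`, route `route-CriticalPhenomena-CardyMonotoneApproach`, sub-problem
`CardyFormulaZ2`; BC3 skeleton registered by the skeleton registrar `skel-stmt-CriticalPhenomena-5844`,
2026-08-17)

The crux (rank 2 of the route; Conjecture M, parity-free form): for all integers `p, q ≥ 1` the exact
box-crossing sequence `n ↦ a(p,q,n) := crossingProb half (p*n+1) (q*n) = P_½(LR([0,pn+1]×[0,qn]))` is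
eventually monotone (non-decreasing or non-increasing on `Set.Ici N` for some `N`).

## The line: Ziff's finite-size law (values) + an a-priori curvature bound ⟹ sign of the increments
## (discrete Landau–Kolmogorov) ⟹ M on the wide side; exact duality and the self-dual square do the rest

WHY one believes M at all (route header, sources Ziff1992/Ziff1996/Ziff2011, LPS94 §3): the finite-size
corrections to the critical crossing probability of a box of fixed aspect ratio are a sum of PURE POWERS of
the size with a non-vanishing, one-signed leading amplitude (effective aspect ratio `r + c/L`, correction
exponents). A one-signed leading power does NOT by itself give monotone approach (a remainder `o(n^{-θ})`
may still oscillate fast at amplitude below the trend but with increments above the trend's increments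
`≍ n^{-θ-1}`); what is needed in addition is an a-priori bound on the SECOND differences at the natural
scale `n^{-θ-2}` (which the same pure-power structure predicts, and which alone carries no sign). The two
together force the first differences to be those of the trend, `Δa = -cθ n^{-θ-1}(1+o(1))`, by the discrete
Landau–Kolmogorov interpolation `|Δr| ≤ 2‖r‖/L + L‖Δ²r‖/2` on windows `L = √ε·n`. So the crux is cut into

* `stub_levelLaw` — ZIFF'S FINITE-SIZE LAW on the wide side `q < p` (OPEN; percolation/transfer-matrix;
  XL): `a(p,q,n) = Π + c·n^{-θ}·(1 + o(1))` with `θ > 0` and `c ≠ 0` — stated as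
  `n^θ (a(p,q,n) − Π) → c`. It contains the existence of the box limit `Π(p/q)` and the non-vanishing of
  the leading power-law amplitude; it does not control increments.
* `stub_curvatureBound` — A-PRIORI CURVATURE BOUND at the scale of the law (OPEN; percolation; L–XL):
  whenever the level law holds with data `(Π, c, θ)`, the second differences satisfy
  `|a(n+2) − 2a(n+1) + a(n)| ≤ K·n^{-(θ+2)}` for `n ≥ N₀`. Two-sided, no sign: alone (or with a level law
  without rate) it allows slow sign changes of the increments.
* `stub_tauberian` — DISCRETE LANDAU–KOLMOGOROV STEP (pure real analysis, provable now; M): for ANY real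
  sequence `f`, level law `n^θ (f n − Π) → c ≠ 0` plus curvature bound `|Δ²f_n| ≤ K n^{-(θ+2)}`
  (`n ≥ N₀`) give `0 < c·(f n − f (n+1))` for all large `n` (increments eventually have the sign of `−c`).

Composition `MonotoneApproach_of` (REAL proof, no `sorry`): trichotomy on `(p,q)`.  `q < p`: the three
stubs give an eventual strict sign of the increments, hence `AntitoneOn` (`c > 0`) or `MonotoneOn`
(`c < 0`) on `Set.Ici N`.  `q = p`: the sequence is identically `1/2` (tree:
`crossingProb_half_succ_self_holds`).  `p < q`: apply the stubs to `(q,p)` and transport through the EXACT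
duality `a(p,q,n) = 1 − a(q,p,n)` (tree: `crossingProb_add_crossingProb_symm_holds`, `symm_half`), which
reverses the direction.  The direction is not asserted by the crux, so both signs of `c` are admissible.

Device (D-0027 §3.3, as in `Cruxes/CardyRectangle/Lines/birth.lean`): each stub is a sorried theorem
`Holds.stub_<name> : <full statement over tree declarations>` (registered under the short name
`stub_<name>` with that text) plus the by-name handle `def stub_<name> : Prop := type_of% Holds.stub_<name>`;
the hypotheses of `MonotoneApproach_of` are exactly the three handles, and `MonotoneApproach_proof` applies
it to the three sorried stubs (certifying mechanically that the handles ARE the stub statements).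
Sorries: exactly the three `Holds.stub_*`; nothing else.

Honest note for the tenure planner: `stub_levelLaw` is strictly stronger than what the route extracts from
M downstream (existence of the box limits `Π(p/q)`, used in `RectGlue` (i)); if it lands, `RectGlue` can be
fed directly.  The crux as filed is an increment-sign statement and this is the only mechanism on record
for it (no cross-size coupling is known — route header, "why it might fail").

Disproof used: none — no `Disproof.lean`, no `Negative/` lemma and no other workfile exists for this crux
at registration (`ledger crux ls stmt-CriticalPhenomena-5844`: "(no workfiles yet)", 2026-08-17); the
negatives index of the summit has no statement about box-crossing sequences, finite-size laws or
monotonicity in the size.  No stub is a restatement: stub 3 contains no percolation at all, stubs 1–2 are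
statements about levels / second differences (not increments) on the wide side only, and
`stub → MonotoneApproach` / `stub → CardyFormulaZ2` fail the cheap probes (BC3, see `Lines/birth.md`).
-/

noncomputable section

namespace Summit.CriticalPhenomena.CardyFormulaZ2.Cruxes.MonotoneApproach.Birth

open Filter Topology
open Literature.Probability.Percolation (crossingProb half symm_half crossingProb_half_succ_self_holds
  crossingProb_add_crossingProb_symm_holds)
open Summit.CriticalPhenomena.CardyFormulaZ2.Theses.CardyMonotoneApproach (MonotoneApproach)

/-! ### The three registered stubs (the ONLY `sorry`s of this file) and their by-name handles -/

/-- **Stub 1 — Ziff's finite-size law on the wide side (OPEN; XL).** For `1 ≤ q < p` the exact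
box-crossing probabilities `a(p,q,n) = P_½(LR([0,pn+1]×[0,qn]))` approach a limit `Π` along a pure power
with a non-vanishing amplitude: `n^θ · (a(p,q,n) − Π) → c` with `θ > 0`, `c ≠ 0`
(Ziff 1996 effective aspect ratio; Ziff 2011 correction-to-scaling exponents; LPS 1994 §3 tables). -/
protected theorem Holds.stub_levelLaw : ∀ p q : ℕ, 1 ≤ q → q < p → ∃ Lim c θ : ℝ, 0 < θ ∧ c ≠ 0 ∧ Filter.Tendsto (fun n : ℕ => (n : ℝ) ^ θ * (Literature.Probability.Percolation.crossingProb Literature.Probability.Percolation.half (p * n + 1) (q * n) - Lim)) Filter.atTop (nhds c) := by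
  sorry

/-- By-name handle of the registered stub `Holds.stub_levelLaw`. -/
def stub_levelLaw : Prop := type_of% Holds.stub_levelLaw

/-- **Stub 2 — a-priori curvature bound at the scale of the law (OPEN; L–XL).** On the wide side, whenever
the level law holds with data `(Π, c, θ)`, the second differences of `n ↦ a(p,q,n)` are
`O(n^{-(θ+2)})`: `|a(n+2) − 2a(n+1) + a(n)| ≤ K·n^{-(θ+2)}` for `n ≥ N₀` (pure-power structure of the
transfer-matrix / corrections-to-scaling expansion; two-sided, no sign information). -/
protected theorem Holds.stub_curvatureBound : ∀ p q : ℕ, 1 ≤ q → q < p → ∀ Lim c θ : ℝ, 0 < θ → c ≠ 0 → Filter.Tendsto (fun n : ℕ => (n : ℝ) ^ θ * (Literature.Probability.Percolation.crossingProb Literature.Probability.Percolation.half (p * n + 1) (q * n) - Lim)) Filter.atTop (nhds c) → ∃ (K : ℝ) (N₀ : ℕ), ∀ n : ℕ, N₀ ≤ n → |Literature.Probability.Percolation.crossingProb Literature.Probability.Percolation.half (p * (n + 2) + 1) (q * (n + 2)) - 2 * Literature.Probability.Percolation.crossingProb Literature.Probability.Percolation.half (p * (n + 1) + 1) (q * (n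 + 1)) + Literature.Probability.Percolation.crossingProb Literature.Probability.Percolation.half (p * n + 1) (q * n)| ≤ K * (n : ℝ) ^ (-(θ + 2)) := by
  sorry

/-- By-name handle of the registered stub `Holds.stub_curvatureBound`. -/
def stub_curvatureBound : Prop := type_of% Holds.stub_curvatureBound

/-- **Stub 3 — discrete Landau–Kolmogorov / Tauberian step (pure real analysis; provable now; M).** For any
real sequence `f`: a level law `n^θ (f n − Π) → c` with `θ > 0`, `c ≠ 0` and a curvature bound
`|f(n+2) − 2 f(n+1) + f(n)| ≤ K n^{-(θ+2)}` (`n ≥ N₀`) force the increments to be those of the trend,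
`f n − f (n+1) = cθ n^{-θ-1} (1 + o(1))`; in particular `0 < c · (f n − f (n+1))` for all large `n`.
(Window interpolation `|Δr_n| ≤ 2 sup_{m ≥ n}|r_m| / L + L · sup|Δ²r| / 2`, `L = ⌈√ε n⌉`.) -/
protected theorem Holds.stub_tauberian : ∀ (f : ℕ → ℝ) (Lim c θ K : ℝ) (N₀ : ℕ), 0 < θ → c ≠ 0 → Filter.Tendsto (fun n : ℕ => (n : ℝ) ^ θ * (f n - Lim)) Filter.atTop (nhds c) → (∀ n : ℕ, N₀ ≤ n → |f (n + 2) - 2 * f (n + 1) + f n| ≤ K * (n : ℝ) ^ (-(θ + 2))) → ∃ N : ℕ, ∀ n : ℕ, N ≤ n → 0 < c * (f n - f (n + 1)) := by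
  sorry

/-- By-name handle of the registered stub `Holds.stub_tauberian`. -/
def stub_tauberian : Prop := type_of% Holds.stub_tauberian

/-! ### Sorry-free glue lemmas used by the composition -/

/-- Eventual successor inequalities give antitonicity on the tail `Set.Ici N`. -/
theorem antitoneOn_Ici_of_succ_le {f : ℕ → ℝ} {N : ℕ} (h : ∀ n : ℕ, N ≤ n → f (n + 1) ≤ f n) :
    AntitoneOn f (Set.Ici N) := by
  intro a ha b _ hab
  have ha' : N ≤ a := Set.mem_Ici.mp ha
  have key : ∀ k : ℕ, f (a + k) ≤ f a := by
    intro k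
    induction k with
    | zero => simp
    | succ k ih =>
      calc f (a + (k + 1)) = f (a + k + 1) := rfl
        _ ≤ f (a + k) := h (a + k) (le_trans ha' (Nat.le_add_right a k))
        _ ≤ f a := ih
  have hb : b = a + (b - a) := (Nat.add_sub_cancel' hab).symm
  rw [hb]
  exact key (b - a)

/-- Eventual successor inequalities give monotonicity on the tail `Set.Ici N`. -/
theorem monotoneOn_Ici_of_le_succ {f : ℕ → ℝ} {N : ℕ} (h : ∀ n : ℕ, N ≤ n → f n ≤ f (n + 1)) :
    MonotoneOn f (Set.Ici N) := by
  intro a ha b _ hab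
  have ha' : N ≤ a := Set.mem_Ici.mp ha
  have key : ∀ k : ℕ, f a ≤ f (a + k) := by
    intro k
    induction k with
    | zero => simp
    | succ k ih =>
      calc f a ≤ f (a + k) := ih
        _ ≤ f (a + k + 1) := h (a + k) (le_trans ha' (Nat.le_add_right a k))
        _ = f (a + (k + 1)) := rfl
  have hb : b = a + (b - a) := (Nat.add_sub_cancel' hab).symm
  rw [hb]
  exact key (b - a)

/-- An eventual strict sign of `c · (f n − f (n+1))` with `c ≠ 0` makes `f` eventually monotone or
eventually antitone. -/
theorem monotoneOn_or_antitoneOn_of_sign {f : ℕ → ℝ} {c : ℝ} {N : ℕ} (hc : c ≠ 0)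
    (h : ∀ n : ℕ, N ≤ n → 0 < c * (f n - f (n + 1))) :
    MonotoneOn f (Set.Ici N) ∨ AntitoneOn f (Set.Ici N) := by
  rcases lt_or_gt_of_ne hc with hneg | hpos
  · -- `c < 0`: increments are positive
    left
    refine monotoneOn_Ici_of_le_succ fun n hn => ?_
    have := h n hn
    nlinarith
  · -- `c > 0`: increments are negative
    right
    refine antitoneOn_Ici_of_succ_le fun n hn => ?_
    have := h n hn
    nlinarith

/-- Exact duality of the box family: `a(p,q,n) + a(q,p,n) = 1`
(`crossingProb half (m+1) n + crossingProb (σ half) (n+1) m = 1` with `σ half = half`). -/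
theorem boxSeq_add_boxSeq_swap (p q n : ℕ) :
    crossingProb half (p * n + 1) (q * n) + crossingProb half (q * n + 1) (p * n) = 1 := by
  have h := crossingProb_add_crossingProb_symm_holds half (p * n) (q * n)
  rwa [symm_half] at h

/-- The self-dual diagonal: `a(p,p,n) = 1/2` for every `n`. -/
theorem boxSeq_diag (p n : ℕ) : crossingProb half (p * n + 1) (p * n) = 1 / 2 :=
  crossingProb_half_succ_self_holds (p * n)

/-- The wide side `q < p`: the three stubs give an eventual strict sign of the increments. -/
theorem wide_eventual_sign (h₁ : stub_levelLaw) (h₂ : stub_curvatureBound) (h₃ : stub_tauberian)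
    (p q : ℕ) (hq : 1 ≤ q) (hlt : q < p) :
    ∃ (c : ℝ) (N : ℕ), c ≠ 0 ∧ ∀ n : ℕ, N ≤ n →
      0 < c * (crossingProb half (p * n + 1) (q * n) - crossingProb half (p * (n + 1) + 1) (q * (n + 1))) := by
  dsimp only [stub_levelLaw, stub_curvatureBound, stub_tauberian] at h₁ h₂ h₃
  obtain ⟨Lim, c, θ, hθ, hc, hlim⟩ := h₁ p q hq hlt
  obtain ⟨K, N₀, hK⟩ := h₂ p q hq hlt Lim c θ hθ hc hlim
  obtain ⟨N, hN⟩ := h₃ (fun n : ℕ => crossingProb half (p * n + 1) (q * n)) Lim c θ K N₀ hθ hc hlim hK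
  exact ⟨c, N, hc, hN⟩

/-! ### Composition (sorry-free): the three stubs imply the crux BY NAME -/

/-- **`MonotoneApproach` from the three stubs (real proof).** See the module docstring. -/
theorem MonotoneApproach_of (h₁ : stub_levelLaw) (h₂ : stub_curvatureBound) (h₃ : stub_tauberian) :
    MonotoneApproach := by
  intro p q hp hq
  rcases lt_trichotomy q p with hlt | heq | hgt
  · -- WIDE boxes `q < p`: eventual strict sign of the increments (stubs 1–3)
    obtain ⟨c, N, hc, hN⟩ := wide_eventual_sign h₁ h₂ h₃ p q hq hlt
    exact ⟨N, monotoneOn_or_antitoneOn_of_sign (f := fun n : ℕ => crossingProb half (p * n + 1) (q * n))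
      hc hN⟩
  · -- the self-dual family `q = p`: identically `1/2`
    subst heq
    refine ⟨0, Or.inl ?_⟩
    intro a _ b _ _
    show crossingProb half (q * a + 1) (q * a) ≤ crossingProb half (q * b + 1) (q * b)
    simp only [boxSeq_diag, le_refl]
  · -- TALL boxes `p < q`: the stubs at `(q, p)` and exact duality `a(p,q,n) = 1 − a(q,p,n)`
    obtain ⟨c, N, hc, hN⟩ := wide_eventual_sign h₁ h₂ h₃ q p hp hgt
    refine ⟨N, monotoneOn_or_antitoneOn_of_sign (f := fun n : ℕ => crossingProb half (p * n + 1) (q * n))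
      (c := -c) (neg_ne_zero.mpr hc) fun n hn => ?_⟩
    have hx : crossingProb half (p * n + 1) (q * n) = 1 - crossingProb half (q * n + 1) (p * n) := by
      linarith [boxSeq_add_boxSeq_swap p q n]
    have hy : crossingProb half (p * (n + 1) + 1) (q * (n + 1))
        = 1 - crossingProb half (q * (n + 1) + 1) (p * (n + 1)) := by
      linarith [boxSeq_add_boxSeq_swap p q (n + 1)]
    show 0 < -c * (crossingProb half (p * n + 1) (q * n) - crossingProb half (p * (n + 1) + 1) (q * (n + 1)))
    have e : -c * (crossingProb half (p * n + 1) (q * n) - crossingProb half (p * (n + 1) + 1) (q * (n + 1)))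
        = c * (crossingProb half (q * n + 1) (p * n) - crossingProb half (q * (n + 1) + 1) (p * (n + 1))) := by
      rw [hx, hy]; ring
    rw [e]
    exact hN n hn

/-- **The crux BY NAME from the three stubs** (depends on `sorryAx` ONLY through the three `Holds.stub_*`;
this line also certifies that the by-name handles ARE the stub statements). -/
theorem MonotoneApproach_proof : MonotoneApproach :=
  MonotoneApproach_of Holds.stub_levelLaw Holds.stub_curvatureBound Holds.stub_tauberian

end Summit.CriticalPhenomena.CardyFormulaZ2.Cruxes.MonotoneApproach.Birth

end
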